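import Summits.ValiantsHypothesis.ValiantsHypothesis.Theorems.NewtonUnitEquationsTwoProductsMomentRecordDefs

/-!
# val-idea-crit-8 (g2) — R12 RUNG TEXT over the LANDED Defs ✓ p670581 (director-valiant R299 (2): «the first record-lemma rung is typed by
# crit-8 (owner) as ONE statement over the landed Defs and sig-firsted to val-neg-1 g6 before any prover takes it»).
# APPEND-ONLY companion of `…TwoProductsMomentRecordDefs` (no landed decl is touched); statements only (`def … : Prop`), NO proofs, NOT a claim.
# VP ≠ VNP is NOT proved; 5906 is OPEN; nothing here is a summit-level statement.
#
# WHAT CHANGED SINCE W3 rev 2 (= the landed Defs): val-idea-37 g3's card `Cruxes/TwoProducts/Ideas/dvr-collapse-records.md` gives a PAPER PROOF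
# of (A) `MomentRecordLaw` — K2 (DVR record lemma: every carrier of a record pair is an `ℂ[z]_(z)`-local record) + K1 (a chain of linear
# pencils in `O^{2m}` has `≤ 4m − 2` record steps) + the class count — refereed line by line by the critic (VERDICT #14: PASS) and toy-checked
# independently (K1: designed chains attain `2M − 2`, random search never exceeds; K2: 0 violations in 2 593 + 2 746 records).  Auditing my own
# typed transfer (A) ⇒ (B) against that proof surfaced two repairs, typed HERE as new names (the landed ones stay as they are):
#  (R1) `NegWeightUsed` — letter-negativity only for letters that OCCUR (what `ValidWeight` supplies); K2 extends to it (orientation cost(d) ≥ 0: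
#       a carrier of non-positive base cost is pure-shift, so the `𝟙`-coefficient of its local relation lies in `z·O` and the same-layer competitor
#       vanishes).  (A♯) below is stated with it and is STRONGER than the landed (A).
#  (R2) `CarrierDissociatedAll` — shallow pairs separated from ALL pairs (as `ExpBlock.ShallowGraded`); needed ONLY for the naive downstairs identity
#       `logCoeff e = c_S · layer k S`.  rev 3 (22:2xZ): NOT needed for the rung — val-lit-p3 g17's upstairs (lumped free ring) transport reaches the
#       LANDED (B) under depth-m dissociation (glue of record `shiftedCarrier_of_lawUsed` below); (B♯)/`…All` stay as a-fortiori variants.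
# THE RUNG OF RECORD (one statement, sig-first to val-neg-1 g6): rev 1 named (A♯) `MomentRecordBound`; rev 2 (22:1xZ, after val-idea-35 g3's
# K1-free route II, memo rev 2 §4b + `RKRecordLemma.lean` 2affe72eeaed103e) names the ROUTE-NEUTRAL law form (A∘) `MomentRecordLawUsed`, which both
# routes reach; (A♯) stays as route I's explicit bound.  K2 `RecordCarrierLocal` (M) and K1 `LocalRecordCount` (M/L: lattice colength over a DVR)
# are typed as prover food; rev 3: the class rung it feeds is the LANDED (B) `ShiftedCarrierLaw` via `shiftedCarrier_of_lawUsed` (M⁺, p3 g17's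
# upstairs toolkit); (B♯) `ShiftedCarrierLawAll` is an a-fortiori variant.
-/

set_option linter.dupNamespace false

noncomputable section

open Classical Polynomial

namespace Summit.ValiantsHypothesis.ValiantsHypothesis.Theorems.NewtonUnitEquations.TwoProducts.MomentRecord
open scoped BigOperators
open Summit.ValiantsHypothesis.ValiantsHypothesis.Theorems.NewtonUnitEquations.TwoProducts.FormalLogLinearisation
open Summit.ValiantsHypothesis.ValiantsHypothesis.Theorems.NewtonUnitEquations.TwoProducts.PlanarCell

variable {m n : ℕ}

/-- (R1) Letter-negative weights for the letters that OCCUR: `wt ξ (x i) < 0` if some term (either side) has a nonzero coefficient on `X^{x i}`,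
and `wt ξ (x i + d) < 0` if some term has one on `X^{x i + d}`.  `NegWeight x d ξ → NegWeightUsed α β α' β' x d ξ` trivially. -/
def NegWeightUsed (α β α' β' : Fin m → Fin n → ℂ) (x : Fin n → Expo) (d : Fin 2 → ℤ) (ξ : Fin 2 → ℝ) : Prop :=
  ∀ i, (((∃ j, α j i ≠ 0) ∨ ∃ j, α' j i ≠ 0) → wt ξ (x i) < 0) ∧
    (((∃ j, β j i ≠ 0) ∨ ∃ j, β' j i ≠ 0) → wtZ ξ (shiftZ x d i) < 0)

/-- (R2) Shallow pairs are separated from ALL pairs by their planar point (no size bound on `S'`). Implies the landed `CarrierDissociated x d m`. -/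
def CarrierDissociatedAll (x : Fin n → Expo) (d : Fin 2 → ℤ) (m : ℕ) : Prop :=
  ∀ (S S' : Fin n → ℕ) (k k' : ℕ), size S ≤ m → k ≤ size S → k' ≤ size S' →
    ptZ x d S k = ptZ x d S' k' → (S = S' ∧ k = k')

/-- The pencil entry of term `j` at carrier `i` after the collapse `X^{x i + d} ↦ z • X^{x i}`: `α j i + z β j i` (`z` = `Polynomial.X`). -/
def pencil (α β : Fin m → Fin n → ℂ) (j : Fin m) (i : Fin n) : ℂ[X] :=
  Polynomial.C (α j i) + Polynomial.X * Polynomial.C (β j i)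

/-- Carrier `i` is a LOCAL NON-RECORD for the carrier costs `cx` (val-idea-37 g3, K2): its pencil column (both sides, `2m` coordinates) lies in the
`ℂ[z]_(z)`-span of the all-ones column and the pencil columns of the OTHER carriers of cost `≤ cx i` — a polynomial relation with a unit
denominator `q`, `q(0) ≠ 0`, the same `𝟙`-coefficient `μ` on both sides. -/
def LocalNonRecord (α β α' β' : Fin m → Fin n → ℂ) (cx : Fin n → ℝ) (i : Fin n) : Prop :=
  ∃ (q μ : ℂ[X]) (ν : Fin n → ℂ[X]), q.coeff 0 ≠ 0 ∧ ν i = 0 ∧ (∀ i', cx i < cx i' → ν i' = 0) ∧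
    (∀ j, q * pencil α β j i = μ + ∑ i', ν i' * pencil α β j i') ∧
    (∀ j, q * pencil α' β' j i = μ + ∑ i', ν i' * pencil α' β' j i')

/-- The local records of a cost function (only its preorder matters). -/
def localRecords (α β α' β' : Fin m → Fin n → ℂ) (cx : Fin n → ℝ) : Set (Fin n) :=
  {i | ¬ LocalNonRecord α β α' β' cx i}

/-- Carrier cost = minus the weight of the base letter. -/
def cxOf (ξ : Fin 2 → ℝ) (x : Fin n → Expo) (i : Fin n) : ℝ := - wt ξ (x i)

/-- Shift cost = minus the weight of the shift vector. -/
def cdOf (ξ : Fin 2 → ℝ) (d : Fin 2 → ℤ) : ℝ := -(ξ 0 * (d 0 : ℝ) + ξ 1 * (d 1 : ℝ))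

/-- **K2 — THE DVR RECORD LEMMA** (val-idea-37 g3; M).  For a weight negative on the occurring letters, every carrier occurring in a record pair is a
local record: for the pencils `α + zβ` and the base costs when `cost(d) ≥ 0`, and for the SWAPPED pencils `β + zα` (same cost preorder) when
`cost(d) ≤ 0` (the orientation in which the shift is the non-negative-cost move).  Any shallow bound `m'`. -/
def RecordCarrierLocal : Prop :=
  ∀ (m n m' : ℕ) (α β α' β' : Fin m → Fin n → ℂ) (x : Fin n → Expo) (d : Fin 2 → ℤ) (ξ : Fin 2 → ℝ) (p : (Fin n → ℕ) × ℕ),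
    NegWeightUsed α β α' β' x d ξ → IsRecord α β α' β' x d m' ξ p → ∀ i, 0 < p.1 i →
      (0 ≤ cdOf ξ d → i ∈ localRecords α β α' β' (cxOf ξ x)) ∧
      (cdOf ξ d ≤ 0 → i ∈ localRecords β α β' α' (cxOf ξ x))

/-- **K1 — THE LOCAL-RECORD COUNT** (val-idea-37 g3; M/L).  For ANY pencil data and ANY cost function the local records number `≤ 4m`
(paper: `≤ 2M − 2 = 4m − 2` along a linear refinement — rank jumps `≤ M − 1` plus colength refinements `≤ v_z(det) ≤ #jumps` — and the preorder's
local records are records of every linear refinement).  No weights, no geometry, no sparsity. -/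
def LocalRecordCount : Prop :=
  ∀ (m n : ℕ) (α β α' β' : Fin m → Fin n → ℂ) (cx : Fin n → ℝ), (localRecords α β α' β' cx).ncard ≤ 4 * m

/-- **(A♯) MOMENT RECORD BOUND — THE R12 RUNG STATEMENT OF RECORD** (paper-proved: K2 + K1 + «planar weights induce ≤ 2n² + 4 (cost-preorder,
orientation) classes; per class the record multisets are supported on ≤ 4m local records, sizes ≤ m, layers ≤ m + 1»).  No sparsity and no
dissociation hypothesis at the level of pairs; STRONGER than the landed (A) (`NegWeightUsed`, every `n`). -/
def MomentRecordBound : Prop :=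
  ∀ (m n : ℕ) (α β α' β' : Fin m → Fin n → ℂ) (x : Fin n → Expo) (d : Fin 2 → ℤ),
    ((shallowPairs n m).filter fun p => ∃ ξ : Fin 2 → ℝ, NegWeightUsed α β α' β' x d ξ ∧ IsRecord α β α' β' x d m ξ p).card
      ≤ (2 * n ^ 2 + 4) * (m + 1) * Nat.choose (5 * m) m

/-- **(A∘) MOMENT RECORD LAW, used-letter form — THE ROUTE-NEUTRAL RUNG STATEMENT OF RECORD** (rev 2): the landed (A) with `NegWeightUsed`
in place of `NegWeight` and without the sparsity / dissociation decorations (only `n ≤ 2mt` is kept, which is what the transfer supplies).  Reached by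
route I (val-idea-37 g3: K2 + K1 ⇒ (A♯) ⇒ (A∘), constants absolute) and by route II (val-idea-35 g3 memo rev 2 §4b: band death + R-exchange +
size-layer independence + greedy dimension count ⇒ per-class count `2^{O(log² m)} ≤ 2^{7m}`, K1-free, `(a,b) = (7,2)` up to the class factor). -/
def MomentRecordLawUsed : Prop :=
  ∃ a b : ℕ, ∀ (m n t : ℕ) (α β α' β' : Fin m → Fin n → ℂ) (x : Fin n → Expo) (d : Fin 2 → ℤ),
    2 ≤ t → n ≤ 2 * m * t →
    ((shallowPairs n m).filter fun p => ∃ ξ : Fin 2 → ℝ, NegWeightUsed α β α' β' x d ξ ∧ IsRecord α β α' β' x d m ξ p).card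
      ≤ 2 ^ (a * m) * (t + 2) ^ b

/-- (A♯) ⇒ (A∘), S-sized arithmetic (`(2n²+4)(m+1)·C(5m,m) ≤ 2^(a m)(t+2)^b` under `n ≤ 2mt`, e.g. `(a,b) = (9,4)`). -/
def momentRecordLawUsed_of_bound : Prop := MomentRecordBound → MomentRecordLawUsed

/-- (A∘) ⇒ the landed (A), S-sized (`NegWeight → NegWeightUsed`; drop the unused hypotheses). -/
def momentRecordLaw_of_lawUsed : Prop := MomentRecordLawUsed → MomentRecordLaw

/-- K2 + K1 ⇒ (A♯), M-sized (the class count over the central line arrangement `{ξ·(x i − x i') = 0} ∪ {ξ·d = 0}` and `#{S : supp S ⊆ R, |S| ≤ m} ≤ C(#R + m, m)`). -/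
def momentRecordBound_of_local : Prop := RecordCarrierLocal → LocalRecordCount → MomentRecordBound

/-- (A♯) ⇒ the landed (A), S-sized arithmetic (`NegWeight → NegWeightUsed`, `n ≤ 2mt`, `C(5m,m) ≤ 2^{5m}`). -/
def momentRecordLaw_of_bound : Prop := MomentRecordBound → MomentRecordLaw

/-- **(B♯) SHIFTED-CARRIER CELL LAW** = the landed (B) `ShiftedCarrierLaw` with (R2) `CarrierDissociatedAll` in place of `CarrierDissociated`
(the class rung the transfer actually reaches). -/
def ShiftedCarrierLawAll : Prop :=
  ∃ a b : ℕ, ∀ (m t n : ℕ) (u v : Fin m → MvPolynomial (Fin 2) ℂ) (x : Fin n → Expo) (d : Fin 2 → ℤ),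
    2 ≤ t →
    (∀ j, MvPolynomial.coeff 0 (u j) = 0 ∧ (u j).support.card ≤ t) →
    (∀ j, MvPolynomial.coeff 0 (v j) = 0 ∧ (v j).support.card ≤ t) →
    (∀ e ∈ tailSupport u v, ∃ i, e = x i ∨ ∀ c, ((e c : ℕ) : ℤ) = shiftZ x d i c) →
    CarrierDissociatedAll x d m →
    ∀ (R : Expo → Expo → Prop) (S : Finset Expo), IsCellFamily u v R S → S.card ≤ 2 ^ (a * m) * (t + 2) ^ b

/-- (A♯) ⇒ (B♯), M-sized transfer (restrict to the `≤ 2mt` carriers that occur; `α j i := [X^{x i}] u_j`, `β j i := [X^{x i + d}] u_j`, resp. `v`;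
a visible point `e` of the cell is a strict top of `logSupport` for a valid `ξ_e` (`NegWeightUsed` holds for `ξ_e`), `e` is a shallow pair point,
`logCoeff e = c_S · layer k S` with `c_S ≠ 0` by (R2), so `(S,k)` is live and — every other live shallow pair being another point of `logSupport` —
a record for `ξ_e`; distinct points give distinct pairs).  Typed target, not proved here. -/
def shiftedCarrierAll_of_bound : Prop := MomentRecordBound → ShiftedCarrierLawAll

/-- (A∘) ⇒ (B♯), the same M-sized transfer from the route-neutral law form (constants `(a,b) ↦ (a,b)`); a-fortiori corollary of the glue of record below. -/
def shiftedCarrierAll_of_lawUsed : Prop := MomentRecordLawUsed → ShiftedCarrierLawAll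

/-- **THE GLUE OF RECORD (rev 3): (A∘) ⇒ the LANDED (B) `ShiftedCarrierLaw`** (depth-`m` `CarrierDissociated` = the bigger class; (R2) is NOT needed —
val-lit-p3 g17's structural note, evidence #44 on 5906, checked by the critic): work UPSTAIRS in the lumped free ring `ℂ[y_1..y_n][z]`,
`R_j := Σ_i (α j i + β j i z) y_i`, graded by the weight `w(y^S z^k) := wtZ ξ (ptZ x d S k)`; `𝚫 := Π(1+R_j) − Π(1+R'_j)` has only SHALLOW monomials and
specialises to `tailDiff u v`, so depth-`m` dissociation alone gives `[e] tailDiff = [y^S z^k] 𝚫` for the unique shallow `(S,k) ↦ e` and `𝚫 ≡ G·y^S z^k`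
at and above `w₀ = wt ξ e` when `e` is a strict top (`G ≠ 0`); every occurring monomial `y_i`, `y_i z` has negative weight (`NegWeightUsed` from
`ValidWeight`), so the exp/log leading-term transport gives `Λ := Σ log(1+R_j) − Σ log(1+R'_j) ≡ G·y^S z^k` at and above `w₀`; upstairs there are NO
collisions at any depth and `[y^S z^k] Λ = (−1)^{|S|+1}(|S|−1)!/ΠS_i! · layer k S`, hence `(S,k)` is live and strictly heavier than every other live pair
of ANY size — a record for `ξ` with `NegWeightUsed`; restrict to the `≤ 2mt` occurring carriers; points ↦ pairs injective.  Size M⁺ (p3's toolkit). -/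
def shiftedCarrier_of_lawUsed : Prop := MomentRecordLawUsed → ShiftedCarrierLaw

end Summit.ValiantsHypothesis.ValiantsHypothesis.Theorems.NewtonUnitEquations.TwoProducts.MomentRecord

end
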